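import Summits.AtomisticToContinuum.Crystallization.Theorems.PhononSlackCertificatesPeriodicGivenLayeredConvexity
import Summits.AtomisticToContinuum.Crystallization.Theorems.PhononSlackCertificatesPeriodicGivenLayeredLayerCake3

/-!
# Crux `HcpLandscapeGap` (route `HullExactificationCascade`, stmt-AtomisticToContinuum-12087),
# line `birth`: stub `stub_jensenShift` (W1) — Jensen over cyclic shifts for the block energy

The energy of a free block of `n + 1` alternating triangular layers of spacing `a ∈ [47/50, 1]`
with increments `Δ 0, …, Δ (n-1)` in the band `[39a/50, 17a/20]`,
`F_n(Δ) = ∑_{i<n} ∑_{j∈(i,n]} Φ_{j-i}(Δ i + ⋯ + Δ (j-1))`,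
`Φ_k(H) = layerInteraction V_LJ a H (0 if k even else 1) 1`, satisfies
`F_n(μ·1) + κ ∑_{i<n} (Δ i - μ)² ≤ F_n(Δ) + C`, `μ = (∑_{i<n} Δ i)/n`, with absolute `κ > 0`, `C`.

Proof (all bookkeeping, no numerics beyond the two landed inputs):
* `LayeredHull.stub_convexity` (midpoint strong convexity of `F_n` on the band box, constant `κ₀`)
  makes `G = F_n - 2κ₀‖·‖²` midpoint convex on the box; midpoint convexity gives Jensen for
  equal-weight averages of `2^k` box points (induction) and then of any `m ≥ 1` points (pad with
  copies of the mean — Cauchy's trick);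
* Jensen for the `n` cyclic shifts `i ↦ Δ ((i + r) % n)`: their average is the constant profile
  `μ·1`, their norms agree with `‖Δ‖²`, and `‖Δ‖² - nμ² = ∑ (Δ i - μ)²`;
* shift defect: the CYCLIC block energy (all `n` cyclic windows of every span `≤ n`) is exactly
  shift invariant and differs from `F_n` by the wrapped windows only: for the start `i` these are
  the spans `> n - i`, each bounded by `|Φ| ≤ 192/H⁴ ≤ 768/span⁴`
  (`LayeredHull.cake_abs_layerInteraction_le`, `H ≥ span · 0.7332`), and
  `∑_i ∑_{span > n-i} 768/span⁴ ≤ ∑_i 1536/(n-i+1)² ≤ 3072`.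
Constants: `κ = 2κ₀`, `C = 6144`. [folklore]
-/

namespace Summit.AtomisticToContinuum.Crystallization.Theorems.HcpLandscapeGapBirth

open Finset
open Literature.MathematicalPhysics.StatisticalMechanics

/-! ## Cyclic reindexing and an inverse-square sum -/

/-- Cyclic reindexing of a sum over `range n`: `∑_{i<n} f ((i + r) % n) = ∑_{i<n} f i`. [folklore] -/
theorem jsh_sum_mod {M : Type*} [AddCommMonoid M] (f : ℕ → M) {n : ℕ} (hn : 0 < n) (r : ℕ) :
    ∑ i ∈ range n, f ((i + r) % n) = ∑ i ∈ range n, f i := by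
  haveI : NeZero n := ⟨hn.ne'⟩
  rw [Finset.sum_range (fun i => f ((i + r) % n)), Finset.sum_range f]
  have key : ∀ i : Fin n, ((i : ℕ) + r) % n = ((i + Fin.ofNat n r : Fin n) : ℕ) := by
    intro i
    rw [Fin.val_add, Fin.val_ofNat, Nat.add_mod_mod]
  simp_rw [key]
  exact Equiv.sum_comp (Equiv.addRight (Fin.ofNat n r)) (fun i : Fin n => f i)

/-- Cyclic reindexing, shift on the left: `∑_{i<n} f ((r + i) % n) = ∑_{i<n} f i`. [folklore] -/
theorem jsh_sum_mod' {M : Type*} [AddCommMonoid M] (f : ℕ → M) {n : ℕ} (hn : 0 < n) (r : ℕ) :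
    ∑ i ∈ range n, f ((r + i) % n) = ∑ i ∈ range n, f i := by
  simpa only [Nat.add_comm r] using jsh_sum_mod f hn r

/-- Telescoping bound `∑_{k<N} 1/(k+1)² ≤ 2 - 2/(N+1)` (from `1/(k+1)² ≤ 2/((k+1)(k+2))`).
[folklore] -/
theorem jsh_sum_inv_sq (N : ℕ) :
    ∑ k ∈ range N, (((k : ℝ) + 1) ^ 2)⁻¹ ≤ 2 - 2 / ((N : ℝ) + 1) := by
  induction N with
  | zero => norm_num
  | succ N ih =>
    rw [Finset.sum_range_succ]
    push_cast
    have h0 : (0 : ℝ) < (N : ℝ) + 1 := by positivity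
    have key : (((N : ℝ) + 1) ^ 2)⁻¹ ≤ 2 / ((N : ℝ) + 1) - 2 / ((N : ℝ) + 1 + 1) := by
      rw [div_sub_div _ _ h0.ne' (by positivity), inv_eq_one_div,
        div_le_div_iff₀ (by positivity) (by positivity)]
      nlinarith [mul_nonneg h0.le (Nat.cast_nonneg N : (0 : ℝ) ≤ N)]
    linarith

/-- `∑_{k ∈ s} 1/(k+1)² ≤ 2` for every finite set of naturals. [folklore] -/
theorem jsh_sum_inv_sq_le_two (s : Finset ℕ) (N : ℕ) (hs : s ⊆ range N) :
    ∑ k ∈ s, (((k : ℝ) + 1) ^ 2)⁻¹ ≤ 2 :=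
  calc ∑ k ∈ s, (((k : ℝ) + 1) ^ 2)⁻¹ ≤ ∑ k ∈ range N, (((k : ℝ) + 1) ^ 2)⁻¹ :=
        Finset.sum_le_sum_of_subset_of_nonneg hs fun _ _ _ => by positivity
    _ ≤ 2 - 2 / ((N : ℝ) + 1) := jsh_sum_inv_sq N
    _ ≤ 2 := sub_le_self _ (by positivity)

/-! ## Jensen's inequality for midpoint-convex functions, equal weights -/

/-- **Dyadic Jensen.** If `B` is closed under equal-weight averages and `G` is midpoint convex on
`B`, then `G` of the average of `2^k` points of `B` is at most the average of their `G`-values.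
[folklore] -/
theorem jsh_jensen_two_pow (G : (ℕ → ℝ) → ℝ) (B : Set (ℕ → ℝ))
    (hB : ∀ (m : ℕ) (x : ℕ → ℕ → ℝ), 0 < m → (∀ r, r < m → x r ∈ B) →
      (fun i => (∑ r ∈ range m, x r i) / m) ∈ B)
    (hG : ∀ x y, x ∈ B → y ∈ B → G (fun i => (x i + y i) / 2) ≤ (G x + G y) / 2) (k : ℕ) :
    ∀ x : ℕ → ℕ → ℝ, (∀ r, r < 2 ^ k → x r ∈ B) →
      G (fun i => (∑ r ∈ range (2 ^ k), x r i) / (2 ^ k : ℕ)) ≤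
        (∑ r ∈ range (2 ^ k), G (x r)) / (2 ^ k : ℕ) := by
  induction k with
  | zero => intro x _; simp
  | succ k ih =>
    intro x hx
    have hpow : 2 ^ (k + 1) = 2 ^ k + 2 ^ k := by rw [pow_succ]; ring
    have hx1 : ∀ r, r < 2 ^ k → x r ∈ B := fun r hr => hx r (by rw [hpow]; omega)
    have hx2 : ∀ r, r < 2 ^ k → x (2 ^ k + r) ∈ B := fun r hr => hx _ (by rw [hpow]; omega)
    have h1 := ih x hx1
    have h2 := ih (fun r => x (2 ^ k + r)) hx2
    have hmid := hG _ _ (hB (2 ^ k) x (by positivity) hx1)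
      (hB (2 ^ k) (fun r => x (2 ^ k + r)) (by positivity) hx2)
    have hP : (0 : ℝ) < (2 ^ k : ℕ) := by positivity
    have hc : ((2 ^ (k + 1) : ℕ) : ℝ) = 2 * (2 ^ k : ℕ) := by rw [hpow]; push_cast; ring
    have havg : (fun i => (∑ r ∈ range (2 ^ (k + 1)), x r i) / (2 ^ (k + 1) : ℕ)) =
        fun i => ((∑ r ∈ range (2 ^ k), x r i) / (2 ^ k : ℕ) +
          (∑ r ∈ range (2 ^ k), x (2 ^ k + r) i) / (2 ^ k : ℕ)) / 2 := by
      funext i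
      rw [hc, hpow, Finset.sum_range_add]
      ring
    rw [havg, hc, hpow, Finset.sum_range_add, le_div_iff₀ (by positivity)]
    rw [le_div_iff₀ hP] at h1 h2
    have h3 := mul_le_mul_of_nonneg_left hmid hP.le
    linarith

/-- **Jensen for equal weights** (any number `m ≥ 1` of points): `m · G(mean) ≤ ∑ G(x_r)`; pad
the family with `2^m - m` copies of its mean and use the dyadic case. [folklore] -/
theorem jsh_jensen (G : (ℕ → ℝ) → ℝ) (B : Set (ℕ → ℝ))
    (hB : ∀ (m : ℕ) (x : ℕ → ℕ → ℝ), 0 < m → (∀ r, r < m → x r ∈ B) →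
      (fun i => (∑ r ∈ range m, x r i) / m) ∈ B)
    (hG : ∀ x y, x ∈ B → y ∈ B → G (fun i => (x i + y i) / 2) ≤ (G x + G y) / 2)
    {m : ℕ} (hm : 0 < m) (x : ℕ → ℕ → ℝ) (hx : ∀ r, r < m → x r ∈ B) :
    (m : ℝ) * G (fun i => (∑ r ∈ range m, x r i) / m) ≤ ∑ r ∈ range m, G (x r) := by
  set μ : ℕ → ℝ := fun i => (∑ r ∈ range m, x r i) / m with hμ
  have hμB : μ ∈ B := hB m x hm hx
  have hlt : m < 2 ^ m := Nat.lt_two_pow_self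
  have hm0 : (0 : ℝ) < m := by exact_mod_cast hm
  have hJ := jsh_jensen_two_pow G B hB hG m (fun r => if r < m then x r else μ) (by
    intro r _
    split_ifs with h
    · exact hx r h
    · exact hμB)
  have hsumx : ∀ i, ∑ r ∈ range m, x r i = m * μ i := by
    intro i
    simp only [hμ]
    field_simp
  have hS : ∀ i, ∑ r ∈ range (2 ^ m), (if r < m then x r else μ) i = (2 ^ m : ℕ) * μ i := by
    intro i
    rw [← Finset.sum_range_add_sum_Ico _ hlt.le,
      Finset.sum_congr rfl (fun r hr => by rw [if_pos (mem_range.1 hr)] :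
        ∀ r ∈ range m, (if r < m then x r else μ) i = x r i),
      Finset.sum_congr rfl (fun r hr => by rw [if_neg (by rw [mem_Ico] at hr; omega)] :
        ∀ r ∈ Ico m (2 ^ m), (if r < m then x r else μ) i = μ i),
      Finset.sum_const, Nat.card_Ico, nsmul_eq_mul, hsumx, Nat.cast_sub hlt.le]
    push_cast
    ring
  have hSG : ∑ r ∈ range (2 ^ m), G (if r < m then x r else μ) =
      ∑ r ∈ range m, G (x r) + ((2 ^ m : ℕ) - m : ℝ) * G μ := by
    rw [← Finset.sum_range_add_sum_Ico _ hlt.le,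
      Finset.sum_congr rfl (fun r hr => by rw [if_pos (mem_range.1 hr)] :
        ∀ r ∈ range m, G (if r < m then x r else μ) = G (x r)),
      Finset.sum_congr rfl (fun r hr => by rw [if_neg (by rw [mem_Ico] at hr; omega)] :
        ∀ r ∈ Ico m (2 ^ m), G (if r < m then x r else μ) = G μ),
      Finset.sum_const, Nat.card_Ico, nsmul_eq_mul, Nat.cast_sub hlt.le]
  have havg : (fun i => (∑ r ∈ range (2 ^ m), (if r < m then x r else μ) i) / (2 ^ m : ℕ)) =
      μ := by
    funext i
    rw [hS]
    field_simp
  rw [havg, hSG, le_div_iff₀ (by positivity)] at hJ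
  push_cast at hJ
  nlinarith [hJ]

/-! ## The shift defect -/

/-- Decay of a window term: for a window of `k + 1` increments, `H ≥ (k+1) · 39a/50 ≥ 0.7332 (k+1)`,
so `|Φ_δ(H)| ≤ 192/H⁴ ≤ 768/(k+1)⁴`. [folklore] -/
theorem jsh_term_bound (a : ℝ) (ha : 47 / 50 ≤ a) (ha1 : a ≤ 1) (k : ℕ) (H : ℝ)
    (hH : ((k : ℝ) + 1) * (39 / 50 * a) ≤ H) (δ : ℤ) :
    |layerInteraction lennardJones a H δ 1| ≤ 768 / ((k : ℝ) + 1) ^ 4 := by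
  have hk0 : (0 : ℝ) ≤ k := Nat.cast_nonneg k
  have hs : 1833 / 2500 * ((k : ℝ) + 1) ≤ H := by nlinarith
  have hH0 : 7 / 10 ≤ H := by nlinarith
  have hHabs : 7 / 10 ≤ |H| := by rw [abs_of_pos (by linarith)]; exact hH0
  refine (LayeredHull.cake_abs_layerInteraction_le a H ha ha1 hHabs δ).trans ?_
  have h4 : (1833 / 2500 : ℝ) ^ 4 * ((k : ℝ) + 1) ^ 4 ≤ H ^ 4 := by
    rw [← mul_pow]
    exact pow_le_pow_left₀ (by positivity) hs 4
  have h5 : (0 : ℝ) ≤ ((k : ℝ) + 1) ^ 4 := by positivity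
  norm_num at h4
  rw [div_le_div_iff₀ (by positivity) (by positivity)]
  linarith

/-- **Shift defect.** For increments in the band, the cyclic block energy
`∑_{i<n} ∑_{k<n} Φ_{k+1}(∑_{m ≤ k} Δ ((i+m) % n))` and the block energy `F_n(Δ)` differ by at most
`3072`: the windows of `F_n` are the non-wrapping cyclic windows (`k + 1 ≤ n - i`), and the wrapped
ones contribute `≤ ∑_i ∑_{k ≥ n-i} 768/(k+1)⁴ ≤ ∑_i 1536/(n-i+1)² ≤ 3072`. [folklore] -/
theorem jsh_defect (a : ℝ) (ha : 47 / 50 ≤ a) (ha1 : a ≤ 1) {n : ℕ} (hn : 0 < n) (Δ : ℕ → ℝ)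
    (hΔ : ∀ i, i < n → 39 / 50 * a ≤ Δ i ∧ Δ i ≤ 17 / 20 * a) :
    |(∑ i ∈ range n, ∑ k ∈ range n, layerInteraction lennardJones a
        (∑ m ∈ range (k + 1), Δ ((i + m) % n)) (if Even (k + 1) then 0 else 1) 1) -
      ∑ i ∈ range n, ∑ j ∈ Ioc i n, layerInteraction lennardJones a
        (∑ l ∈ Ico i j, Δ l) (if Even (j - i) then 0 else 1) 1| ≤ 3072 := by
  -- name the cyclic window terms
  obtain ⟨T, hT⟩ : ∃ T : ℕ → ℕ → ℝ, ∀ i k, T i k = layerInteraction lennardJones a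
      (∑ m ∈ range (k + 1), Δ ((i + m) % n)) (if Even (k + 1) then 0 else 1) 1 :=
    ⟨_, fun _ _ => rfl⟩
  have hTb : ∀ i k, |T i k| ≤ 768 / ((k : ℝ) + 1) ^ 4 := by
    intro i k
    rw [hT]
    refine jsh_term_bound a ha ha1 k _ ?_ _
    have h : ∑ _m ∈ range (k + 1), 39 / 50 * a ≤ ∑ m ∈ range (k + 1), Δ ((i + m) % n) :=
      Finset.sum_le_sum fun m _ => (hΔ _ (Nat.mod_lt _ hn)).1
    rw [Finset.sum_const, Finset.card_range, nsmul_eq_mul] at h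
    push_cast at h
    exact h
  -- the block energy in window form: the non-wrapping cyclic windows
  have hF : ∀ i ∈ range n, ∑ j ∈ Ioc i n, layerInteraction lennardJones a
      (∑ l ∈ Ico i j, Δ l) (if Even (j - i) then 0 else 1) 1 = ∑ k ∈ range (n - i), T i k := by
    intro i hi
    rw [mem_range] at hi
    rw [LayeredHull.cvx_sum_Ioc_eq_sum_range]
    refine Finset.sum_congr rfl fun k hk => ?_
    rw [mem_range] at hk
    have e1 : i + 1 + k - i = k + 1 := by omega
    rw [hT, Finset.sum_Ico_eq_sum_range, e1]
    congr 1
    refine Finset.sum_congr rfl fun m hm => ?_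
    rw [mem_range] at hm
    rw [Nat.mod_eq_of_lt (by omega)]
  simp only [← hT]
  rw [Finset.sum_congr rfl hF, ← Finset.sum_sub_distrib]
  have htail : ∀ i ∈ range n, (∑ k ∈ range n, T i k) - ∑ k ∈ range (n - i), T i k =
      ∑ k ∈ Ico (n - i) n, T i k := by
    intro i _
    rw [← Finset.sum_range_add_sum_Ico _ (Nat.sub_le n i)]
    ring
  rw [Finset.sum_congr rfl htail]
  have hinj : Set.InjOn (fun i : ℕ => n - i) ↑(range n) := by
    intro x hx y hy hxy
    simp only [coe_range, Set.mem_Iio] at hx hy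
    simp only at hxy
    omega
  calc |∑ i ∈ range n, ∑ k ∈ Ico (n - i) n, T i k|
      ≤ ∑ i ∈ range n, |∑ k ∈ Ico (n - i) n, T i k| := Finset.abs_sum_le_sum_abs _ _
    _ ≤ ∑ i ∈ range n, ∑ k ∈ Ico (n - i) n, |T i k| :=
        Finset.sum_le_sum fun i _ => Finset.abs_sum_le_sum_abs _ _
    _ ≤ ∑ i ∈ range n, ∑ k ∈ Ico (n - i) n,
          768 / (((n - i : ℕ) : ℝ) + 1) ^ 2 * (((k : ℝ) + 1) ^ 2)⁻¹ := by
        refine Finset.sum_le_sum fun i _ => Finset.sum_le_sum fun k hk => ?_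
        rw [mem_Ico] at hk
        refine (hTb i k).trans ?_
        have hNk : ((n - i : ℕ) : ℝ) ≤ k := by exact_mod_cast hk.1
        have hk0 : (0 : ℝ) < (k : ℝ) + 1 := by positivity
        calc (768 : ℝ) / ((k : ℝ) + 1) ^ 4 = 768 / ((k : ℝ) + 1) ^ 2 * (((k : ℝ) + 1) ^ 2)⁻¹ := by
              field_simp
          _ ≤ 768 / (((n - i : ℕ) : ℝ) + 1) ^ 2 * (((k : ℝ) + 1) ^ 2)⁻¹ := by
              gcongr
    _ = ∑ i ∈ range n, 768 / (((n - i : ℕ) : ℝ) + 1) ^ 2 *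
          ∑ k ∈ Ico (n - i) n, (((k : ℝ) + 1) ^ 2)⁻¹ := by
        simp_rw [Finset.mul_sum]
    _ ≤ ∑ i ∈ range n, 768 / (((n - i : ℕ) : ℝ) + 1) ^ 2 * 2 := by
        gcongr with i hi
        exact jsh_sum_inv_sq_le_two _ n fun k hk => by
          rw [mem_Ico] at hk; rw [mem_range]; exact hk.2
    _ = ∑ N ∈ (range n).image (fun i : ℕ => n - i), 1536 * (((N : ℝ) + 1) ^ 2)⁻¹ := by
        rw [Finset.sum_image hinj]
        exact Finset.sum_congr rfl fun i _ => by ring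
    _ ≤ 1536 * 2 := by
        rw [← Finset.mul_sum]
        gcongr
        exact jsh_sum_inv_sq_le_two _ (n + 1) fun N hN => by
          simp only [mem_image, mem_range] at hN ⊢
          obtain ⟨i, hi, rfl⟩ := hN
          omega
    _ = 3072 := by norm_num

/-! ## The stub -/

-- the registered signature binds an unused window index `l` in the constant-profile sum
set_option linter.unusedVariables false in
/-- **Stub W1 (`stub_jensenShift`).** Jensen over the cyclic shifts for the alternating block energy:
for `a ∈ [47/50, 1]`, `n ≥ 1` and increments `Δ i ∈ [39a/50, 17a/20]` (`i < n`),
`F_n(μ·1) + κ ∑_{i<n} (Δ i - μ)² ≤ F_n(Δ) + C` with `μ = (∑_{i<n} Δ i)/n`, `κ = 2κ₀ > 0` (`κ₀` the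
midpoint-convexity constant of `LayeredHull.stub_convexity`) and `C = 6144` (twice the shift defect).
[folklore] -/
theorem stub_jensenShift : ∃ κ : ℝ, 0 < κ ∧ ∃ C : ℝ, ∀ (a : ℝ), 47 / 50 ≤ a → a ≤ 1 → ∀ (n : ℕ), 1 ≤ n → ∀ Δ : ℕ → ℝ, (∀ i : ℕ, i < n → 39 / 50 * a ≤ Δ i ∧ Δ i ≤ 17 / 20 * a) → (∑ i ∈ Finset.range n, ∑ j ∈ Finset.Ioc i n, Literature.MathematicalPhysics.StatisticalMechanics.layerInteraction Literature.MathematicalPhysics.StatisticalMechanics.lennardJones a (∑ l ∈ Finset.Ico i j, ((∑ i' ∈ Finset.range n, Δ i') / n)) (if Even (j - i) then 0 else 1) 1) + κ * (∑ i ∈ Finset.range n, (Δ i - (∑ i' ∈ Finset.range n, Δ i') / n) ^ 2) ≤ (∑ i ∈ Finset.range n, ∑ j ∈ Finset.Ioc i n, Literature.MathematicalPhysics.StatisticalMechanics.layerInteraction Literature.MathematicalPhysics.StatisticalMechanics.lennardJones a (∑ l ∈ Finset.Ico i j, Δ l) (if Even (j - i) then 0 else 1) 1) + C := by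
  obtain ⟨κ₀, hκ₀, hcvx⟩ := LayeredHull.stub_convexity
  refine ⟨2 * κ₀, by positivity, 6144, ?_⟩
  intro a ha ha1 n hn Δ hΔ
  have hn0 : 0 < n := hn
  have hnR : (0 : ℝ) < n := by exact_mod_cast hn0
  -- the block energy, the cyclic block energy, the corrected energy (kept opaque)
  obtain ⟨F, hF⟩ : ∃ F : (ℕ → ℝ) → ℝ, ∀ x : ℕ → ℝ, F x = ∑ i ∈ range n, ∑ j ∈ Ioc i n,
      layerInteraction lennardJones a (∑ l ∈ Ico i j, x l) (if Even (j - i) then 0 else 1) 1 :=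
    ⟨_, fun _ => rfl⟩
  obtain ⟨Fc, hFc⟩ : ∃ Fc : (ℕ → ℝ) → ℝ, ∀ x : ℕ → ℝ, Fc x = ∑ i ∈ range n, ∑ k ∈ range n,
      layerInteraction lennardJones a (∑ m ∈ range (k + 1), x ((i + m) % n))
        (if Even (k + 1) then 0 else 1) 1 := ⟨_, fun _ => rfl⟩
  obtain ⟨G, hG⟩ : ∃ G : (ℕ → ℝ) → ℝ, ∀ x : ℕ → ℝ,
      G x = F x - 2 * κ₀ * ∑ i ∈ range n, x i ^ 2 := ⟨_, fun _ => rfl⟩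
  set B : Set (ℕ → ℝ) := {x | ∀ i, i < n → 39 / 50 * a ≤ x i ∧ x i ≤ 17 / 20 * a} with hB
  have hΔB : Δ ∈ B := hΔ
  -- midpoint convexity of the corrected energy on the box
  have hGmid : ∀ x y, x ∈ B → y ∈ B → G (fun i => (x i + y i) / 2) ≤ (G x + G y) / 2 := by
    intro x y hx hy
    have h : κ₀ * ∑ i ∈ range n, (x i - y i) ^ 2 ≤
        F x + F y - 2 * F (fun l => (x l + y l) / 2) := by
      rw [hF, hF, hF]
      exact hcvx a ha ha1 n x y hx hy
    have hid : ∑ i ∈ range n, ((x i + y i) / 2) ^ 2 = (∑ i ∈ range n, x i ^ 2 +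
        ∑ i ∈ range n, y i ^ 2) / 2 - (∑ i ∈ range n, (x i - y i) ^ 2) / 4 := by
      rw [← Finset.sum_add_distrib, Finset.sum_div, Finset.sum_div, ← Finset.sum_sub_distrib]
      exact Finset.sum_congr rfl fun i _ => by ring
    rw [hG, hG, hG, hid]
    linarith
  -- equal-weight averages of box points stay in the box
  have hBavg : ∀ (m : ℕ) (x : ℕ → ℕ → ℝ), 0 < m → (∀ r, r < m → x r ∈ B) →
      (fun i => (∑ r ∈ range m, x r i) / m) ∈ B := by
    intro m x hm hx
    show ∀ i, i < n → 39 / 50 * a ≤ (∑ r ∈ range m, x r i) / m ∧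
      (∑ r ∈ range m, x r i) / m ≤ 17 / 20 * a
    intro i hi
    have hmR : (0 : ℝ) < m := by exact_mod_cast hm
    have hlo : ∑ _r ∈ range m, 39 / 50 * a ≤ ∑ r ∈ range m, x r i :=
      Finset.sum_le_sum fun r hr => ((hx r (mem_range.1 hr)) i hi).1
    have hhi : ∑ r ∈ range m, x r i ≤ ∑ _r ∈ range m, 17 / 20 * a :=
      Finset.sum_le_sum fun r hr => ((hx r (mem_range.1 hr)) i hi).2
    rw [Finset.sum_const, Finset.card_range, nsmul_eq_mul] at hlo hhi
    constructor
    · rw [le_div_iff₀ hmR]; linarith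
    · rw [div_le_iff₀ hmR]; linarith
  -- the cyclic shifts of the increment profile
  obtain ⟨X, hX⟩ : ∃ X : ℕ → ℕ → ℝ, ∀ r i, X r i = Δ ((i + r) % n) := ⟨_, fun _ _ => rfl⟩
  have hXB : ∀ r, r < n → X r ∈ B := by
    intro r _
    show ∀ i, i < n → 39 / 50 * a ≤ X r i ∧ X r i ≤ 17 / 20 * a
    intro i _
    rw [hX]
    exact hΔ _ (Nat.mod_lt _ hn0)
  -- Jensen over the shifts; their average is the constant profile
  have hJ := jsh_jensen G B hBavg hGmid hn0 X hXB
  set μ : ℝ := (∑ i' ∈ range n, Δ i') / n with hμ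
  have havg : (fun i => (∑ r ∈ range n, X r i) / n) = fun _ => μ := by
    funext i
    simp only [hX]
    rw [jsh_sum_mod' Δ hn0 i]
  rw [havg] at hJ
  -- the shifts have the norm of `Δ`
  have hnorm : ∀ r, ∑ i ∈ range n, X r i ^ 2 = ∑ i ∈ range n, Δ i ^ 2 := by
    intro r
    simp only [hX]
    exact jsh_sum_mod (fun l => Δ l ^ 2) hn0 r
  -- the cyclic energy is shift invariant
  have hFcX : ∀ r, Fc (X r) = Fc Δ := by
    intro r
    rw [hFc, hFc]
    have hmod : ∀ i m, ((i + m) % n + r) % n = ((i + r) % n + m) % n := by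
      intro i m
      rw [Nat.mod_add_mod, Nat.mod_add_mod, Nat.add_right_comm]
    simp only [hX, hmod]
    exact jsh_sum_mod (fun i' => ∑ k ∈ range n, layerInteraction lennardJones a
      (∑ m ∈ range (k + 1), Δ ((i' + m) % n)) (if Even (k + 1) then 0 else 1) 1) hn0 r
  -- the shift defect, twice
  have hdef : ∀ x, x ∈ B → |Fc x - F x| ≤ 3072 := by
    intro x hx
    rw [hFc, hF]
    exact jsh_defect a ha ha1 hn0 x hx
  have hFX : ∀ r, r < n → F (X r) ≤ F Δ + 6144 := by
    intro r hr
    have h1 := hdef (X r) (hXB r hr)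
    have h2 := hdef Δ hΔB
    rw [hFcX r] at h1
    rw [abs_le] at h1 h2
    linarith [h1.1, h1.2, h2.1, h2.2]
  -- sum of the corrected energies of the shifts
  have hsumG : ∑ r ∈ range n, G (X r) ≤
      n * (F Δ + 6144 - 2 * κ₀ * ∑ i ∈ range n, Δ i ^ 2) := by
    calc ∑ r ∈ range n, G (X r)
        ≤ ∑ _r ∈ range n, (F Δ + 6144 - 2 * κ₀ * ∑ i ∈ range n, Δ i ^ 2) := by
          refine Finset.sum_le_sum fun r hr => ?_
          rw [hG, hnorm r]
          linarith [hFX r (mem_range.1 hr)]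
      _ = n * (F Δ + 6144 - 2 * κ₀ * ∑ i ∈ range n, Δ i ^ 2) := by
          rw [Finset.sum_const, Finset.card_range, nsmul_eq_mul]
  -- the corrected energy of the constant profile and the variance identity
  have hGμ : G (fun _ => μ) = F (fun _ => μ) - 2 * κ₀ * (n * μ ^ 2) := by
    rw [hG, Finset.sum_const, Finset.card_range, nsmul_eq_mul]
  have hs : ∑ i ∈ range n, Δ i = n * μ := by
    rw [hμ]
    field_simp
  have hvar : ∑ i ∈ range n, (Δ i - μ) ^ 2 = ∑ i ∈ range n, Δ i ^ 2 - n * μ ^ 2 := by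
    have h : ∑ i ∈ range n, (Δ i - μ) ^ 2 =
        ∑ i ∈ range n, Δ i ^ 2 - 2 * μ * ∑ i ∈ range n, Δ i + ∑ _i ∈ range n, μ ^ 2 := by
      rw [Finset.mul_sum, ← Finset.sum_sub_distrib, ← Finset.sum_add_distrib]
      exact Finset.sum_congr rfl fun i _ => by ring
    rw [h, hs, Finset.sum_const, Finset.card_range, nsmul_eq_mul]
    ring
  -- conclusion
  have final : F (fun _ => μ) + 2 * κ₀ * ∑ i ∈ range n, (Δ i - μ) ^ 2 ≤ F Δ + 6144 := by
    rw [hvar]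
    rw [hGμ] at hJ
    have h := le_of_mul_le_mul_left (hJ.trans hsumG) hnR
    linarith
  rw [hF, hF] at final
  exact final

end Summit.AtomisticToContinuum.Crystallization.Theorems.HcpLandscapeGapBirth
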